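import Summits.CriticalPhenomena.SAWScalingLimit.Theorems.SAWLoopFugacityFlowIsingBoundaryRatioRadialMainBound
import Summits.CriticalPhenomena.SAWScalingLimit.Theorems.SAWLoopFugacityFlowIsingBoundaryRatioRadialGeometry
import Literature.Probability.LatticeModels.FKIsingRSWHolds
import HarnessLib

/-!
# The radial crossing LOWER bound of the rough half-annulus RSW (clause (iii))
(line `fk-anchor-transfer`, crux `IsingBoundaryRatio`, stmt-CriticalPhenomena-10650; the registered stub
`stub_halfAnnulusRadialCrossingBound : HalfAnnulusRadialCrossingBoundFat`)

**Statement** (`…RadialDefs.lean`). For the chordal chart `φ` of the Dobrushin domain `(D; a, b)` and `M > 1`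
there is `c > 0` such that for every `ε` there is `ρ₀ > 0` with: for every `ρ < ρ₀`, all small `δ` and every
finite volume `Λ` agreeing locally with `Ω_δ` in `B(a, ε)` and containing every site of chart radius `< 2Mρ`,
under the FREE critical FK–Ising measure of the local graph of the edges touching the fattened annulus
`{ρ/2 < |φ⁻¹| < 2Mρ}`, the open radial crossing `AnnCross H In Ann` of the annulus `{ρ < |φ⁻¹| < Mρ}` has
probability `≥ c`.

**Proof** (no boundary RSW needed). The crossing is routed through the BULK: along the images
`z_j = φ(i (3/4) ρ q^j)`, `j ≤ K(M)`, of a geometric progression on the imaginary axis of the chart, where `φ` has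
bounded distortion uniformly in `ρ` (Koebe, `…RadialKoebeChain.lean`), a chain of `L(M) + 1` lattice squares of a
single side `4nδ ≍ r_lo` joins chart radius `< ρ` to chart radius `> Mρ` inside `B(a, ε) ∩ {ρ/2 < |φ⁻¹| < 2Mρ}`
(`radial_geometry`, `…RadialGeometry.lean`); each square crossed both ways and each domino of consecutive
squares crossed the long way — `3 (L + 1)` increasing events, each of probability `≥ c₀` under the free local
measure by the tree's PROVED critical FK–Ising RSW theorem `fkIsing_rsw_holds` (Duminil-Copin–Hongler–Nolin 2011,
Thm 1; translated/transposed forms `fkIsing_rsw.shift`, `fkIsing_rsw.transpose_shift`) and "free measures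
increase with the domain" — occur together with probability `≥ c₀ ^ (3(L+1)) =: c` (FKG), and then glue into an
open path from the first square to the last whose piece between the last visit to chart radius `≤ ρ` and the
next visit to chart radius `≥ Mρ` is the radial crossing (`radial_mainBound`, `…RadialMainBound.lean`). The
constant `c` depends on `M` only (`K(M)`, `L(M)`, `c₀`). [folklore]
-/

noncomputable section

open scoped Classical Topology
open Filter Set Metric SimpleGraph
open Literature.Probability.LatticeModels Literature.Probability.RandomPlanarGeometry
open Literature.Probability.Percolation (BondConfig openCrossing)
open UpperHalfPlane (upperHalfPlaneSet)

namespace Summit.CriticalPhenomena.SAWScalingLimit.Theorems.IsingBoundaryRatio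

/-- **RSW clause (iii): the radial crossing lower bound under the free local measure of the fattened annulus**
(`HalfAnnulusRadialCrossingBoundFat`; see the module docstring for the proof).
[cite: DuminilCopinHonglerNolin2011, Theorem 1] -/
theorem halfAnnulusRadialCrossingBoundFat_holds : HalfAnnulusRadialCrossingBoundFat := by
  intro D φ hφ M hM
  obtain ⟨c₁, hc₁, hRSW₁⟩ := fkIsing_rsw.shift fkIsing_rsw_holds
  obtain ⟨c₂, hc₂, hRSW₂⟩ := fkIsing_rsw.transpose_shift fkIsing_rsw_holds
  set L : ℕ := RadialChain.kSteps M * (8 * 1024 ^ RadialChain.kSteps M + 3) with hL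
  refine ⟨min (min c₁ c₂) 1 ^ (3 * (L + 1)), by positivity, fun ε hε => ?_⟩
  obtain ⟨ρ₀, hρ₀, hgeom⟩ := radial_geometry D φ hφ M hM ε hε
  refine ⟨ρ₀, hρ₀, fun ρ hρ hρlt => ?_⟩
  have hM0 : 0 < M := one_pos.trans hM
  have hρM : ρ < M * ρ := by nlinarith
  filter_upwards [hgeom ρ hρ hρlt] with δ hδ Λ hLA hvol
  obtain ⟨n, v, hn, hstep, hgood, hfirst, hlast⟩ := hδ
  intro H In Ann AnnFat
  have hp_eq : (1 - Real.exp (-2 * criticalBetaTwo)) = criticalFKIsingParam := fkIsingParam_half_log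
  rw [hp_eq]
  have hH : ∀ a b : ↥Λ, H.Adj a b → (zdGraph 2).Adj a.1 b.1 := fun a b hab =>
    meshGraph_le_zdGraph _ _ (discreteDomainGraph_le_meshGraph _ _ hab)
  refine radial_mainBound H In Ann AnnFat (fun a => ‖φ.symm (meshPoint δ a.1)‖) ρ (M * ρ) c₁ c₂ n L v hH hc₁ hc₂
    hRSW₁ hRSW₂ hn hstep (fun i hi x hx => ?_) (fun x hx _ => (hfirst x hx).le) (fun x hx _ => (hlast x hx).le)
  obtain ⟨hmesh, hball, hr1, hr2, hadj⟩ := hgood i hi x hx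
  have hxΛ : x ∈ Λ := hvol x hmesh hr2
  refine ⟨hxΛ, ⟨hball, hr1, by linarith⟩, fun i' hi' y hy hyΛ hxy => ?_, fun h => ⟨hball, h⟩,
    fun h1 h2 => ⟨hball, h1, h2⟩, fun h hmem => ?_⟩
  · exact hadj y (hgood i' hi' y hy).1 hxy
  · rcases hmem with ⟨-, h'⟩ | ⟨-, -, h'⟩
    · exact absurd (h.trans h') (not_le.2 hρM)
    · exact absurd h' (not_lt.2 h)

/-- The registered stub of the skeleton (`stub_halfAnnulusRadialCrossingBound`, STUB 1b‴ of the line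
`fk-anchor-transfer`, rev 11): `HalfAnnulusRadialCrossingBoundFat` holds. [cite: DuminilCopinHonglerNolin2011, Theorem 1] -/
theorem stub_halfAnnulusRadialCrossingBound : HalfAnnulusRadialCrossingBoundFat :=
  halfAnnulusRadialCrossingBoundFat_holds

end Summit.CriticalPhenomena.SAWScalingLimit.Theorems.IsingBoundaryRatio

end
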